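import Summits.ResolutionOfSingularities.ResolutionOfSingularities.Theorems.WeightedInvariantHypersurfaceLocalGameEFT3
import Summits.ResolutionOfSingularities.ResolutionOfSingularities.Theorems.WeightedInvariantEssSmoothLocalHomOrder
import HarnessLib

/-!
# Door assembly H2c″ — [S6] kernel, TORUS CHART: `ι` does not increase at the points of `Y × 𝔾ₘ` over `y`

Route `ResolutionOfSingularities/WeightedInvariant`, crux `Theses.WeightedInvariant.HypersurfaceCentreConstruction`
(stmt-ResolutionOfSingularities-19897), door line `local-engine`, skeleton v3, assembly stub **[S6]** `stub_iotaMax_lt_of_step`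
(holder res-L1-w43-stub-9 = res-D-brk-1; res-type-057 sub-kernel (5c)).

Off the support of the centre the full cobordant blow-up of a Rees filtration is the TRIVIAL one, `B = B₊ = U × 𝔾ₘ =
Spec Γ(Y,U)[t, t⁻¹]` (all pieces `𝒥ₙ(U) = Γ(Y,U)`), so the local ring of `B₊` at a point `b` over `y ∈ U` is the localisation
of the Laurent polynomial ring `A[T;T⁻¹]` (`A = Γ(Y, U)`) at a prime `𝔔` lying over the prime `𝔭` of `y`.  Clause (c10)
`IotaTorusFactorMonotone` of H2a‴ is stated for the LOCAL ring `S = 𝒪_{Y,y} = A_𝔭` and primes of the POLYNOMIAL ring `S[X]`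
over `𝔪_S`.  This file is the commutative-algebra bridge between the two, and the resulting inequality:

* bookkeeping (`comap_C_comap_laurent`, `disjoint_map_C_primeCompl`): the prime `𝔮₀ = 𝔔 ∩ A[X]` lies over `𝔔 ∩ A` and
  misses `C(A ∖ 𝔭)` when `𝔔 ∩ A = 𝔭`;
* `isLocalizationAtPrime_laurent` — `(A[T;T⁻¹])_𝔔` is the localisation of `A[X]` at `𝔮₀` (Laurent polynomials are
  `A[X][X⁻¹]`, Mathlib `LaurentPolynomial.isLocalization`, and localisation is transitive);
* `exists_prime_polynomial_localization` — over `S = A_𝔭`: the prime `𝔮 = 𝔮₀ S[X]` of `S[X]` lies over `𝔪_S` and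
  `S[X]_𝔮 ≃ₐ[A[X]] (A[T;T⁻¹])_𝔔` (both are `A[X]_{𝔮₀}`), the equivalence carrying `C f` to `f`;
* `iota_localization_laurent_le` — **the torus-stalk bound**: for `ι` with (c6) `IotaIsoInvariant` and (c10)
  `IotaTorusFactorMonotone`, if `A_𝔭` is a regular local ring then
  `ι((A[T;T⁻¹])_𝔔, f) ≤ ι(A_𝔭, f)` for every `f ∈ A` and every prime `𝔔` of `A[T;T⁻¹]` with `𝔔 ∩ A = 𝔭`.

What is left to the holder of [S6] on this chart is scheme plumbing only: `𝒪_{B₊,b} ≅ (sectionsRing U)_𝔔` with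
`sectionsRing U = Γ(Y,U)[T;T⁻¹]` off the support (K4), and `ι(y) < ι_max` off the maximum locus
(`iotaAt_lt_iotaMax_of_not_mem_maxLocus`).  The clauses enter as HYPOTHESES on an arbitrary `ι`; nothing about Hironaka's
problem is claimed.  AI-written; weaker than expert review.
-/

noncomputable section

set_option linter.dupNamespace false -- mandated namespace of this single-conjunct summit

open IsLocalRing Polynomial
open scoped LaurentPolynomial
open Literature.AlgebraicGeometry.Resolution

namespace Summit.ResolutionOfSingularities.ResolutionOfSingularities.Cruxes.HypersurfaceCentreConstruction.LocalEngine

section LaurentStalk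

variable {A : Type} [CommRing A]

/-- `A → A[X] → A[T;T⁻¹]` is a scalar tower (`toLaurent (C a) = C a`); stated as a theorem and used via `haveI` inside
proofs (no instance is declared). [folklore] -/
theorem isScalarTower_polynomial_laurent : IsScalarTower A A[X] A[T;T⁻¹] :=
  IsScalarTower.of_algebraMap_eq fun a => by
    rw [LaurentPolynomial.algebraMap_eq_toLaurent, Polynomial.algebraMap_apply, Polynomial.toLaurent_C]
    rfl

/-- The prime `𝔮₀ = 𝔔 ∩ A[X]` of a prime `𝔔` of the Laurent polynomial ring lies over `𝔔 ∩ A`. [folklore] -/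
theorem comap_C_comap_laurent (𝔔 : Ideal A[T;T⁻¹]) :
    (𝔔.comap (algebraMap A[X] A[T;T⁻¹])).comap (C : A →+* A[X]) = 𝔔.comap (algebraMap A A[T;T⁻¹]) := by
  haveI := isScalarTower_polynomial_laurent (A := A)
  rw [Ideal.comap_comap]
  congr 1
  ext a
  simp [IsScalarTower.algebraMap_apply A A[X] A[T;T⁻¹]]

/-- **`(A[T;T⁻¹])_𝔔` is the localisation of `A[X]` at `𝔮₀ = 𝔔 ∩ A[X]`** (`A[T;T⁻¹] = A[X][X⁻¹]` and localisation is
transitive). [folklore] -/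
theorem isLocalizationAtPrime_laurent (𝔔 : Ideal A[T;T⁻¹]) [𝔔.IsPrime] :
    IsLocalization.AtPrime (Localization.AtPrime 𝔔) (𝔔.comap (algebraMap A[X] A[T;T⁻¹])) :=
  IsLocalization.isLocalization_isLocalization_atPrime_isLocalization (M := Submonoid.powers (X : A[X]))
    (Localization.AtPrime 𝔔) 𝔔

variable (𝔭 : Ideal A) [𝔭.IsPrime]

/-- If `𝔔 ∩ A = 𝔭` then `𝔮₀ = 𝔔 ∩ A[X]` misses the image of `A ∖ 𝔭` under `C`. [folklore] -/
theorem disjoint_map_C_primeCompl (𝔔 : Ideal A[T;T⁻¹]) [𝔔.IsPrime]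
    (h𝔔 : 𝔔.comap (algebraMap A A[T;T⁻¹]) = 𝔭) :
    Disjoint (𝔭.primeCompl.map (C : A →+* A[X]) : Set A[X]) (𝔔.comap (algebraMap A[X] A[T;T⁻¹])) := by
  rw [Set.disjoint_left]
  rintro _ ⟨a, ha, rfl⟩ hmem
  have : a ∈ (𝔔.comap (algebraMap A[X] A[T;T⁻¹])).comap (C : A →+* A[X]) := hmem
  rw [comap_C_comap_laurent, h𝔔] at this
  exact ha this

/-- **The polynomial model of the torus stalk.**  Let `S = A_𝔭` and let `𝔔` be a prime of `A[T;T⁻¹]` with `𝔔 ∩ A = 𝔭`.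
Then there is a prime `𝔮` of `S[X]` lying over `𝔪_S` (along `C`) and an `A[X]`-algebra isomorphism
`S[X]_𝔮 ≃ (A[T;T⁻¹])_𝔔` — both are `A[X]_{𝔔 ∩ A[X]}` — carrying `C f` (`f ∈ A` read in `S`) to `f`. [folklore] -/
theorem exists_prime_polynomial_localization (𝔔 : Ideal A[T;T⁻¹]) [𝔔.IsPrime]
    (h𝔔 : 𝔔.comap (algebraMap A A[T;T⁻¹]) = 𝔭) :
    ∃ (𝔮 : Ideal (Localization.AtPrime 𝔭)[X]) (_ : 𝔮.IsPrime),
      𝔮.comap (C : Localization.AtPrime 𝔭 →+* (Localization.AtPrime 𝔭)[X]) =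
          maximalIdeal (Localization.AtPrime 𝔭) ∧
      ∃ e : Localization.AtPrime 𝔮 ≃+* Localization.AtPrime 𝔔,
        ∀ f : A, e (algebraMap (Localization.AtPrime 𝔭)[X] (Localization.AtPrime 𝔮)
            (C (algebraMap A (Localization.AtPrime 𝔭) f))) =
          algebraMap A (Localization.AtPrime 𝔔) f := by
  haveI := isScalarTower_polynomial_laurent (A := A)
  set S := Localization.AtPrime 𝔭 with hS
  -- `A[X] → S[X]` (coefficientwise), a local algebra structure for this proof only
  letI : Algebra A[X] S[X] := Polynomial.algebra A S
  set 𝔮₀ : Ideal A[X] := 𝔔.comap (algebraMap A[X] A[T;T⁻¹]) with h𝔮₀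
  haveI h𝔮₀p : 𝔮₀.IsPrime := Ideal.IsPrime.comap _
  -- `S[X]` is the localisation of `A[X]` at `C(A ∖ 𝔭)`, which misses `𝔮₀`
  haveI hloc : IsLocalization (𝔭.primeCompl.map (C : A →+* A[X])) S[X] :=
    Polynomial.isLocalization 𝔭.primeCompl S
  have hdisj := disjoint_map_C_primeCompl 𝔭 𝔔 h𝔔
  set 𝔮 : Ideal S[X] := 𝔮₀.map (algebraMap A[X] S[X]) with h𝔮
  haveI h𝔮p : 𝔮.IsPrime := IsLocalization.isPrime_of_isPrime_disjoint _ S[X] 𝔮₀ h𝔮₀p hdisj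
  have hcomap : 𝔮.comap (algebraMap A[X] S[X]) = 𝔮₀ :=
    IsLocalization.under_map_of_isPrime_disjoint _ S[X] h𝔮₀p hdisj
  -- both `S[X]_𝔮` and `(A[T;T⁻¹])_𝔔` are the localisation of `A[X]` at `𝔮₀`
  have hM : (𝔮.comap (algebraMap A[X] S[X])).primeCompl = 𝔮₀.primeCompl := by
    ext x
    simp only [Ideal.mem_primeCompl_iff, hcomap]
  haveI h1 : IsLocalization.AtPrime (Localization.AtPrime 𝔮) 𝔮₀ := by
    have h1' := IsLocalization.isLocalization_isLocalization_atPrime_isLocalization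
      (M := 𝔭.primeCompl.map (C : A →+* A[X])) (Localization.AtPrime 𝔮) 𝔮
    change IsLocalization _ _
    exact hM ▸ h1'
  haveI h2 : IsLocalization.AtPrime (Localization.AtPrime 𝔔) 𝔮₀ := isLocalizationAtPrime_laurent 𝔔
  let e : Localization.AtPrime 𝔮 ≃ₐ[A[X]] Localization.AtPrime 𝔔 :=
    IsLocalization.algEquiv 𝔮₀.primeCompl (Localization.AtPrime 𝔮) (Localization.AtPrime 𝔔)
  refine ⟨𝔮, h𝔮p, ?_, e.toRingEquiv, fun f => ?_⟩
  · -- `𝔮 ∩ S = 𝔪_S`: its contraction to `A` is `𝔭`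
    have hP : (𝔮.comap (C : S →+* S[X])).comap (algebraMap A S) = 𝔭 := by
      have hCC : (C : S →+* S[X]).comp (algebraMap A S) = (algebraMap A[X] S[X]).comp (C : A →+* A[X]) := by
        ext a
        simp [Polynomial.algebraMap_def]
      rw [Ideal.comap_comap, hCC, ← Ideal.comap_comap, hcomap, h𝔮₀, comap_C_comap_laurent, h𝔔]
    haveI : (𝔮.comap (C : S →+* S[X])).IsPrime := Ideal.IsPrime.comap _
    have := IsLocalization.map_under 𝔭.primeCompl S (𝔮.comap (C : S →+* S[X]))
    rw [Ideal.under_def, hP, Localization.AtPrime.map_eq_maximalIdeal] at this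
    exact this.symm
  · change e (algebraMap S[X] (Localization.AtPrime 𝔮) (C (algebraMap A S f))) = _
    have hCf : C (algebraMap A S f) = algebraMap A[X] S[X] (C f) := by
      simp [Polynomial.algebraMap_def]
    rw [hCf, ← IsScalarTower.algebraMap_apply, AlgEquiv.commutes,
      IsScalarTower.algebraMap_apply A[X] A[T;T⁻¹] (Localization.AtPrime 𝔔), ← Polynomial.algebraMap_eq,
      ← IsScalarTower.algebraMap_apply A A[X] A[T;T⁻¹], ← IsScalarTower.algebraMap_apply]

end LaurentStalk

/-! ## The torus-stalk bound -/

section Bound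

variable (ι : (R : Type) → [CommRing R] → R → Ordinal.{0})

/-- **Torus-stalk bound for [S6].**  For `ι` with (c6) `IotaIsoInvariant` and (c10) `IotaTorusFactorMonotone`, a commutative
ring `A`, a prime `𝔭` with `A_𝔭` a regular local ring, an element `f ∈ A`, and a prime `𝔔` of the Laurent polynomial ring
`A[T;T⁻¹]` with `𝔔 ∩ A = 𝔭`:  `ι((A[T;T⁻¹])_𝔔, f) ≤ ι(A_𝔭, f)`.  (On the door line: `A = Γ(Y, U)` for an affine `U` off the
support of the centre, where the cobordant blow-up is `U × 𝔾ₘ = Spec A[T;T⁻¹]`; `𝔭` the prime of `y`, `𝔔` that of a point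
of `B₊` over `y`.)  Proof: transport (c10) at the polynomial model `(A_𝔭[X])_𝔮 ≃ (A[T;T⁻¹])_𝔔` of
`exists_prime_polynomial_localization` along (c6). [folklore] -/
theorem iota_localization_laurent_le (hc6 : IotaIsoInvariant ι) (hc10 : IotaTorusFactorMonotone ι)
    {A : Type} [CommRing A] (𝔭 : Ideal A) [𝔭.IsPrime] [IsRegularLocalRing (Localization.AtPrime 𝔭)] (f : A)
    (𝔔 : Ideal A[T;T⁻¹]) [𝔔.IsPrime] (h𝔔 : 𝔔.comap (algebraMap A A[T;T⁻¹]) = 𝔭) :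
    ι (Localization.AtPrime 𝔔) (algebraMap A (Localization.AtPrime 𝔔) f) ≤
      ι (Localization.AtPrime 𝔭) (algebraMap A (Localization.AtPrime 𝔭) f) := by
  obtain ⟨𝔮, h𝔮, hmax, e, he⟩ := exists_prime_polynomial_localization 𝔭 𝔔 h𝔔
  rw [← he f]
  exact (hc6 _ _ e _).trans_le (hc10 (Localization.AtPrime 𝔭) (algebraMap A (Localization.AtPrime 𝔭) f) 𝔮 hmax)

/-- The same bound read in ANY ring isomorphic to the torus stalk (e.g. `𝒪_{B₊,b}`) and any ring isomorphic to `A_𝔭`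
(e.g. `𝒪_{Y,y}`), along isomorphisms matching the images of `f` — the shape the scheme-side plumbing of [S6] delivers.
[folklore] -/
theorem iota_le_of_ringEquiv_laurent_stalk (hc6 : IotaIsoInvariant ι) (hc10 : IotaTorusFactorMonotone ι)
    {A : Type} [CommRing A] (𝔭 : Ideal A) [𝔭.IsPrime] [IsRegularLocalRing (Localization.AtPrime 𝔭)] (f : A)
    (𝔔 : Ideal A[T;T⁻¹]) [𝔔.IsPrime] (h𝔔 : 𝔔.comap (algebraMap A A[T;T⁻¹]) = 𝔭)
    {L S : Type} [CommRing L] [CommRing S] (eL : Localization.AtPrime 𝔔 ≃+* L) (eS : Localization.AtPrime 𝔭 ≃+* S)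
    {gL : L} {gS : S} (hgL : eL (algebraMap A (Localization.AtPrime 𝔔) f) = gL)
    (hgS : eS (algebraMap A (Localization.AtPrime 𝔭) f) = gS) : ι L gL ≤ ι S gS := by
  rw [← hgL, ← hgS, hc6 _ _ eL _, hc6 _ _ eS _]
  exact iota_localization_laurent_le ι hc6 hc10 𝔭 f 𝔔 h𝔔

end Bound

/-! ## rev 2 (append-only): regularity ASCENDS to the torus stalk — singular points of `X × 𝔾ₘ` lie over singular points of `X` -/

section Regular

variable {A : Type} [CommRing A]

/-- **Regularity ascends along the torus chart.**  If `A_𝔭` is a regular local ring then so is `(A[T;T⁻¹])_𝔔` for every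
prime `𝔔` of the Laurent polynomial ring with `𝔔 ∩ A = 𝔭` (polynomial model of `exists_prime_polynomial_localization` +
Mathlib's `Polynomial.isRegularLocalRing_localization_atPrime_of_comap_eq_maximalIdeal`, Matsumura Thm. 19.5).  On the door
line, read with `A := Γ(Y, U) ⧸ (f)` (so `A[T;T⁻¹]` is the coordinate ring of `(X ∩ U) × 𝔾ₘ`): a point of the strict
transform over a REGULAR point of the hypersurface off the centre is regular, i.e. the non-regular locus of the successor
over `Y ∖ supp` lies over the non-regular locus of `V(X)` — what [S6] needs to invoke `ι(y) < ι_max` there. [folklore] -/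
theorem isRegularLocalRing_localization_laurent (𝔭 : Ideal A) [𝔭.IsPrime]
    [IsRegularLocalRing (Localization.AtPrime 𝔭)] (𝔔 : Ideal A[T;T⁻¹]) [𝔔.IsPrime]
    (h𝔔 : 𝔔.comap (algebraMap A A[T;T⁻¹]) = 𝔭) : IsRegularLocalRing (Localization.AtPrime 𝔔) := by
  obtain ⟨𝔮, h𝔮, hmax, e, -⟩ := exists_prime_polynomial_localization 𝔭 𝔔 h𝔔
  haveI hreg := Polynomial.isRegularLocalRing_localization_atPrime_of_comap_eq_maximalIdeal
    (Localization.AtPrime 𝔭) 𝔮 hmax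
  exact @IsRegularLocalRing.of_ringEquiv (Localization.AtPrime 𝔮) _ hreg (Localization.AtPrime 𝔔) _ e

/-- Contrapositive, in the shape [S6] consumes: a NON-regular torus stalk lies over a non-regular point. [folklore] -/
theorem not_isRegularLocalRing_of_laurent (𝔭 : Ideal A) [𝔭.IsPrime] (𝔔 : Ideal A[T;T⁻¹]) [𝔔.IsPrime]
    (h𝔔 : 𝔔.comap (algebraMap A A[T;T⁻¹]) = 𝔭) (h : ¬ IsRegularLocalRing (Localization.AtPrime 𝔔)) :
    ¬ IsRegularLocalRing (Localization.AtPrime 𝔭) :=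
  fun hreg => h (@isRegularLocalRing_localization_laurent A _ 𝔭 _ hreg 𝔔 _ h𝔔)

end Regular

/-! ## rev 3 (append-only): the `𝔪`-adic filtration is PRESERVED AND REFLECTED by the torus stalk (element form of rev 2:
«`f ∈ 𝔪_y²` iff `f ∈ 𝔪_b²`» — how the assembly reads `singImage` through local equations, `…AssemblyPointDict`) -/

section MemPow

/-- **Polynomial level.**  `S` a regular local ring, `𝔮` a prime of `S[X]` over `𝔪_S`, `T = S[X]_𝔮`: for every `n` and
`x ∈ S`, `x ∈ 𝔪_Sⁿ ↔ x ∈ 𝔪_Tⁿ`.  The structure map `S → T` is a local, formally smooth, essentially-of-finite-type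
homomorphism of Noetherian local rings, and those preserve and reflect the powers of the maximal ideals (res-type-070's
`mem_pow_maximalIdeal_iff_of_formallySmooth_essFiniteType`: flat with regular closed fibre, Matsumura §22–23). [folklore] -/
theorem Polynomial.mem_pow_maximalIdeal_iff_localization_of_comap_C {S : Type} [CommRing S] [IsRegularLocalRing S]
    (𝔮 : Ideal S[X]) [𝔮.IsPrime] (h𝔮 : 𝔮.comap (C : S →+* S[X]) = maximalIdeal S) (n : ℕ) (x : S) :
    x ∈ maximalIdeal S ^ n ↔
      algebraMap S (Localization.AtPrime 𝔮) x ∈ maximalIdeal (Localization.AtPrime 𝔮) ^ n := by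
  haveI : IsLocalHom (algebraMap S (Localization.AtPrime 𝔮)) := by
    refine ⟨fun a ha => ?_⟩
    by_contra hna
    have hmem : a ∈ maximalIdeal S := (IsLocalRing.mem_maximalIdeal a).mpr hna
    have hCa : C a ∈ 𝔮 := by
      rw [← h𝔮] at hmem
      exact hmem
    have hmax : algebraMap S[X] (Localization.AtPrime 𝔮) (C a) ∈ maximalIdeal (Localization.AtPrime 𝔮) :=
      (IsLocalization.AtPrime.to_map_mem_maximal_iff (Localization.AtPrime 𝔮) 𝔮 (C a)).mpr hCa
    have hEq : algebraMap S (Localization.AtPrime 𝔮) a = algebraMap S[X] (Localization.AtPrime 𝔮) (C a) := by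
      rw [IsScalarTower.algebraMap_apply S S[X] (Localization.AtPrime 𝔮), Polynomial.algebraMap_eq]
    rw [hEq] at ha
    exact (IsLocalRing.mem_maximalIdeal _).mp hmax ha
  haveI : Algebra.FormallySmooth S (Localization.AtPrime 𝔮) :=
    Algebra.FormallySmooth.comp S S[X] (Localization.AtPrime 𝔮)
  exact mem_pow_maximalIdeal_iff_of_formallySmooth_essFiniteType n x

variable {A : Type} [CommRing A]

/-- The powers of the maximal ideals correspond under a ring isomorphism of local rings. [folklore] -/
theorem mem_pow_maximalIdeal_iff_map_ringEquiv {R R' : Type} [CommRing R] [CommRing R'] [IsLocalRing R]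
    [IsLocalRing R'] (e : R ≃+* R') (x : R) (n : ℕ) :
    x ∈ maximalIdeal R ^ n ↔ e x ∈ maximalIdeal R' ^ n := by
  constructor
  · intro hx
    have h := Ideal.mem_map_of_mem e hx
    rwa [Ideal.map_pow, IsLocalRing.map_ringEquiv_maximalIdeal] at h
  · intro hx
    have h := Ideal.mem_map_of_mem e.symm hx
    rw [Ideal.map_pow, IsLocalRing.map_ringEquiv_maximalIdeal] at h
    simpa using h

/-- **Torus-stalk level: `f ∈ 𝔪_yⁿ ↔ f ∈ 𝔪_bⁿ`.**  For a prime `𝔭` of `A` with `A_𝔭` a regular local ring, a prime `𝔔` of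
`A[T;T⁻¹]` with `𝔔 ∩ A = 𝔭`, every `f ∈ A` and every `n`: `f ∈ 𝔪(A_𝔭)ⁿ ↔ f ∈ 𝔪((A[T;T⁻¹])_𝔔)ⁿ` (polynomial model of
`exists_prime_polynomial_localization` + `Polynomial.mem_pow_maximalIdeal_iff_localization_of_comap_C`).  With `n = 2` and the
point dictionary (`mem_singImage_iff_algebraMap_mem_sq`): over the trivial chart `U × 𝔾ₘ` of the cobordant blow-up, a point
of the strict transform is non-regular iff it lies over a non-regular point of `V(X)`. [folklore] -/
theorem algebraMap_mem_pow_maximalIdeal_laurent_iff (𝔭 : Ideal A) [𝔭.IsPrime]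
    [IsRegularLocalRing (Localization.AtPrime 𝔭)] (𝔔 : Ideal A[T;T⁻¹]) [𝔔.IsPrime]
    (h𝔔 : 𝔔.comap (algebraMap A A[T;T⁻¹]) = 𝔭) (f : A) (n : ℕ) :
    algebraMap A (Localization.AtPrime 𝔭) f ∈ maximalIdeal (Localization.AtPrime 𝔭) ^ n ↔
      algebraMap A (Localization.AtPrime 𝔔) f ∈ maximalIdeal (Localization.AtPrime 𝔔) ^ n := by
  obtain ⟨𝔮, h𝔮, hmax, e, he⟩ := exists_prime_polynomial_localization 𝔭 𝔔 h𝔔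
  rw [Polynomial.mem_pow_maximalIdeal_iff_localization_of_comap_C 𝔮 hmax n, ← he f,
    IsScalarTower.algebraMap_apply (Localization.AtPrime 𝔭) (Localization.AtPrime 𝔭)[X] (Localization.AtPrime 𝔮),
    Polynomial.algebraMap_eq]
  -- transport the power of the maximal ideal along the ring isomorphism `e`
  exact mem_pow_maximalIdeal_iff_map_ringEquiv (R := Localization.AtPrime 𝔮) (R' := Localization.AtPrime 𝔔) e _ n

/-- The `n = 2` contrapositive in the shape [S6] consumes: a point of the trivial chart whose local equation lies in `𝔪²`
(a NON-regular point of the strict transform) lies over a point whose local equation lies in `𝔪²`. [folklore] -/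
theorem algebraMap_mem_sq_of_laurent (𝔭 : Ideal A) [𝔭.IsPrime] [IsRegularLocalRing (Localization.AtPrime 𝔭)]
    (𝔔 : Ideal A[T;T⁻¹]) [𝔔.IsPrime] (h𝔔 : 𝔔.comap (algebraMap A A[T;T⁻¹]) = 𝔭) {f : A}
    (h : algebraMap A (Localization.AtPrime 𝔔) f ∈ maximalIdeal (Localization.AtPrime 𝔔) ^ 2) :
    algebraMap A (Localization.AtPrime 𝔭) f ∈ maximalIdeal (Localization.AtPrime 𝔭) ^ 2 :=
  (algebraMap_mem_pow_maximalIdeal_laurent_iff 𝔭 𝔔 h𝔔 f 2).mpr h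

/-- **Local form (stub-9's (6b) verbatim shape).**  `S` a regular local ring, `𝔔` a prime of `S[T;T⁻¹]` over `𝔪_S`: for
every `f ∈ S` and `n`, `f ∈ 𝔪_Sⁿ ↔ f/1 ∈ 𝔪((S[T;T⁻¹])_𝔔)ⁿ` (the general form at `𝔭 = 𝔪_S`, read back in `S` through
`S ≃ S_{𝔪_S}`). [folklore] -/
theorem mem_pow_maximalIdeal_iff_laurent_of_isLocalRing {S : Type} [CommRing S] [IsRegularLocalRing S]
    (𝔔 : Ideal S[T;T⁻¹]) [𝔔.IsPrime] (h𝔔 : 𝔔.comap (algebraMap S S[T;T⁻¹]) = maximalIdeal S) (f : S) (n : ℕ) :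
    f ∈ maximalIdeal S ^ n ↔
      algebraMap S (Localization.AtPrime 𝔔) f ∈ maximalIdeal (Localization.AtPrime 𝔔) ^ n := by
  -- `S ≃ S_𝔪` as `S`-algebras (every element off `𝔪` is already a unit)
  let e₀ : S ≃ₐ[S] Localization.AtPrime (maximalIdeal S) :=
    IsLocalization.atUnits S (maximalIdeal S).primeCompl (S := Localization.AtPrime (maximalIdeal S))
      (fun x hx => (IsLocalRing.notMem_maximalIdeal.mp hx))
  haveI : IsRegularLocalRing (Localization.AtPrime (maximalIdeal S)) :=
    @IsRegularLocalRing.of_ringEquiv S _ ‹_› _ _ e₀.toRingEquiv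
  rw [← algebraMap_mem_pow_maximalIdeal_laurent_iff (maximalIdeal S) 𝔔 h𝔔 f n]
  have he₀ : algebraMap S (Localization.AtPrime (maximalIdeal S)) f = e₀.toRingEquiv f := by
    change _ = e₀ f
    simp
  rw [he₀]
  exact mem_pow_maximalIdeal_iff_map_ringEquiv (R := S) (R' := Localization.AtPrime (maximalIdeal S)) e₀.toRingEquiv f n

/-- (6b) as stub-9 worded it: `f/1 ∈ 𝔪_𝔔²` (the torus point is a NON-regular point of the strict transform) implies
`f ∈ 𝔪_S²` (the base point is a non-regular point of `V(X)`). [folklore] -/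
theorem mem_sq_of_algebraMap_laurent_mem_sq {S : Type} [CommRing S] [IsRegularLocalRing S]
    (𝔔 : Ideal S[T;T⁻¹]) [𝔔.IsPrime] (h𝔔 : 𝔔.comap (algebraMap S S[T;T⁻¹]) = maximalIdeal S) {f : S}
    (h : algebraMap S (Localization.AtPrime 𝔔) f ∈ maximalIdeal (Localization.AtPrime 𝔔) ^ 2) :
    f ∈ maximalIdeal S ^ 2 :=
  (mem_pow_maximalIdeal_iff_laurent_of_isLocalRing 𝔔 h𝔔 f 2).mpr h

end MemPow

end Summit.ResolutionOfSingularities.ResolutionOfSingularities.Cruxes.HypersurfaceCentreConstruction.LocalEngine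

end
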